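import Literature.NumberTheory.GaloisRepresentations.EisensteinSexticPlaces
import Literature.NumberTheory.GaloisRepresentations.CharacterNormalisedGeneratorHeckeCharacter
import Literature.NumberTheory.GaloisRepresentations.RayClassGroup
import Literature.NumberTheory.EllipticCurves.SexticTwistLSeriesCoefficientsSplit
import HarnessLib

/-!
# Frobenius values and ramification at `λ` of the Größencharakter of `E^k : y² = x³ + k` over `ℚ(ω)`; the datum of Deuring's theorem
# on the row `j = 0` (Ireland–Rosen Ch. 18 Theorems 4 and 7; Silverman II Thm. 10.5)

Topic `Literature/NumberTheory/EllipticCurves`, namespace `Literature.NumberTheory.EllipticCurves.SexticTwist` (sequel of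
`SexticTwistLSeriesCoefficientsSplit`, on the character `EisensteinSextic.psi` of `GaloisRepresentations/EisensteinSexticHeckeCharacter`).
THEOREMS only (no definition, no instance, no named fact).  For `K = ℚ(ω)` abstract (`{ζ : 𝓞 K} (hζ : IsPrimitiveRoot ζ 3)`,
`IsCyclotomicExtension {3} ℚ K`), `k ≠ 0`, the non-trivial automorphism `c` and an embedding `e`:

* §1 ★★ `psi_frobenius` — **Frobenius matching**: for a prime `p ∤ 6k` and `𝔭_v ∋ p`, `(36k) ∤ 𝔭_v`; SPLIT (`c • v ≠ v`, i.e. `p ≡ 1 (3)`):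
  `ψ(v) + ψ(c • v) = a_p(E^k)` and `ψ(v) ψ(c • v) = p` (`lFunction_apply_prime_split` with `ϖ = ϖ_v`, `σ = e`, and `ψ(c•v) = conj ψ(v)`);
  INERT (`c • v = v`, `p ≡ 2 (3)`): `a_p(E^k) = 0` (`lFunction_mordellCurve_apply_prime_eq_zero`) and `ψ(v) = −p` (`(k/p²) = 1`, `(4k/(p))₃ = 1`,
  `ϖ_{(p)} = −p`) — clause (iv) of `Deuring_exists_heckeCharacter_of_maximalCM`, prime by prime, for every `k`;
* §2 (universe `Type`, the currency of `not_isUnramifiedAt_heckeOfGross_of_ne`) ★★ `not_isUnramifiedAt_heckeOfGross_psi_three` — `heckeOfGross ψ` is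
  RAMIFIED at the prime `λ` above `3` for EVERY `k ≠ 0` (`E^k` is bad at `3`): the rational witness `a = 1 + 4m²` (`|k| = 3^t m`, `3 ∤ m`) is
  `≡ 2 (3)`, prime to `6k`, `≡ 1` modulo the prime-to-`3` part of `(36k)`, with `ψ̃((a)) = −S·a ≠ a` (`EisensteinSexticPlaces.idealPow_psi_span_intCast_ne`);
  ★★★ `exists_isGrossencharakter_datum` — the packaged datum (`𝔣 = (36k)`, `𝔣 ∣ 𝔭 ↔ 6k ∈ 𝔭`, `IsGrossencharakter 𝔣 (1,0) ψ₀`, `ψ₀(c•v) = conj ψ₀ v`,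
  the Frobenius block at `p ∤ 6k`, ramification at `λ`, the rational witnesses) in the shape consumed by the BED route's `core_of_datum(_set)`, and
  `exists_heckeCharacter_psi` — clauses (i), (ii), (iv) of Deuring's theorem for the algebraic Hecke character `heckeOfGross ψ`.

What is NOT here (honest gap, next files): the ramification witnesses at the primes of `2k` other than `λ` (they depend on `v_p(k) mod 6`) and the
good-at-`2` class `k = 16u`, `u ≡ 1 (4)` (odd modulus).  Nothing about BSD is proved here; no modularity is used.

## References
* K. Ireland, M. Rosen, *A Classical Introduction to Modern Number Theory*, 2nd ed., GTM 84 (1990), Ch. 18 §3 Theorem 4, §6 Theorem 7, §7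
  («`L(E, s) = L(s, χ)`», «if `P ∣ 6D` then `χ(P) = 0`»). [IrelandRosen1990]
* J. H. Silverman, *Advanced Topics in the Arithmetic of Elliptic Curves* (1994), II Thm. 9.2, Thm. 10.5, Ex. 2.33. [SilvermanATAEC1994]
* J. Neukirch, *Algebraic Number Theory* (1999), Ch. I §3, Ch. VII §6 Cor. (6.14). [NeukirchANT1999]

## Mathlib / tree search
Tree: `EisensteinSextic.{psi, modulus, modulus_le_iff, modulus_ne_bot, psi_of_not_mem, psi_smul_eq_conj, isGrossencharakter_psi_one_zero, cubicLoc,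
coe_cubicLoc_of_not_mem, cubicLoc_pow_three, varpi, span_varpi, varpi_sub_one_mem, varpi_eq_of, not_mem_of_six_mul_not_mem, intCast_mem_smul_iff,
subsingleton_infinitePlace, residueCard_eq_of_mod_three_eq_one, asIdeal_eq_span_of_mod_three_eq_two, smul_eq_self_of_mod_three_eq_two,
smul_ne_self_of_mod_three_eq_one, eq_of_three_mem, isCoprime_span_intCast_modulus, idealPow_psi_span_intCast_ne}` (`EisensteinSexticPrimes/HeckeCharacter/Places`);
`SexticTwist.lFunction_apply_prime_split` (`SexticTwistLSeriesCoefficientsSplit`), `lFunction_mordellCurve_apply_prime_eq_zero` (`MordellCurveSupersingular`);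
`cubicResidueSymbol_natCast_eq_one_of_residueCard_eq_sq` (`CubicCharacterOfTwo`); `not_isUnramifiedAt_heckeOfGross_of_ne`
(`CharacterNormalisedGeneratorHeckeCharacter`); `heckeOfGross`, `heckeOfGross_hasInfinityType`, `heckeOfGross_isUnramifiedAt`, `heckeOfGross_valueAtUniformizer`
(`HeckeCharacterOfGrossencharakter`); `modulusExp`, `pow_modulusExp_dvd` (`RayClassGroup`); `QuarticTwistGrossencharakterRamification.sub_one_mem_pow_modulusExp_of_dvd`
(the `j = 1728` twin; copied privately).  Mathlib: `Nat.exists_eq_pow_mul_and_not_dvd`, `IsCyclotomicExtension.Rat.isTotallyComplex`, `Fintype.prod_subsingleton`,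
`jacobiSym.{legendreSym.to_jacobiSym, sq_one, pow_right}`, `Int.dvd_self_sub_emod`.
-/

noncomputable section

open NumberField IsDedekindDomain IsDedekindDomain.HeightOneSpectrum
open scoped NumberTheorySymbols ComplexConjugate Pointwise

namespace Literature.NumberTheory.EllipticCurves.SexticTwist

open Literature.NumberTheory.GaloisRepresentations Literature.NumberTheory.GaloisRepresentations.EisensteinSextic
open Literature.NumberTheory.LFunctions (idealPow isCoprime_span_of_sub_mem)
open Literature.NumberTheory.LFunctions.AbelianDensity (artinSymbol artinSymbol_asIdeal idealPow_comp_eq)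
open Literature.NumberTheory.Automorphic (RingOfIntegers.coe_algEquiv_smul HeightOneSpectrum.smul_mem_smul_asIdeal_iff)

section Frobenius

variable {K : Type*} [Field K] [NumberField K] {ζ : 𝓞 K} (hζ : IsPrimitiveRoot ζ 3)

/-! ### §1 Frobenius matching against `a_p(E^k)` at the primes `p ∤ 6k` -/

open WeierstrassCurve

variable [IsCyclotomicExtension {3} ℚ K]

omit [IsCyclotomicExtension {3} ℚ K] in
/-- `6k ∉ 𝔭` for `𝔭 ∋ p`, `p ∤ 6k`. [cite: IrelandRosen1990, Ch. 18 §7] -/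
theorem six_mul_not_mem_of_natCast_mem {k : ℤ} {p : ℕ} (hp : p.Prime) (hpk : ¬ (p : ℤ) ∣ 6 * k) {v : HeightOneSpectrum (𝓞 K)}
    (hv : (p : 𝓞 K) ∈ v.asIdeal) : ((6 * k : ℤ) : 𝓞 K) ∉ v.asIdeal := by
  intro h6
  obtain ⟨a, b, hab⟩ := (Nat.prime_iff_prime_int.mp hp).coprime_iff_not_dvd.mpr hpk
  have h1 : (1 : 𝓞 K) = (a : 𝓞 K) * (p : 𝓞 K) + (b : 𝓞 K) * ((6 * k : ℤ) : 𝓞 K) := by exact_mod_cast congrArg (Int.cast (R := 𝓞 K)) hab.symm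
  exact v.isPrime.ne_top ((Ideal.eq_top_iff_one _).mpr (h1 ▸ v.asIdeal.add_mem (v.asIdeal.mul_mem_left _ hv) (v.asIdeal.mul_mem_left _ h6)))

omit [NumberField K] [IsCyclotomicExtension {3} ℚ K] in
/-- `(k, p) = 1` as `Int.gcd`, from `p ∤ k`. [folklore] -/
private theorem gcd_eq_one_of_not_dvd {k : ℤ} {p : ℕ} (hp : p.Prime) (hpk : ¬ (p : ℤ) ∣ k) : k.gcd p = 1 := by
  rw [Int.gcd_eq_natAbs, Int.natAbs_natCast]
  exact ((Nat.Prime.coprime_iff_not_dvd hp).mpr fun hd => hpk (Int.natCast_dvd.mpr hd)).symm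

omit [NumberField K] [IsCyclotomicExtension {3} ℚ K] in
/-- `4k ≡ n (mod 𝔭)` for a natural number `n` prime to `p` (`𝔭 ∋ p ∤ 4k`). [folklore] -/
private theorem exists_nat_mk_four_mul_eq {k : ℤ} {p : ℕ} (hp : p.Prime) (hp2 : p ≠ 2) (hpk : ¬ (p : ℤ) ∣ k)
    {v : HeightOneSpectrum (𝓞 K)} (hv : (p : 𝓞 K) ∈ v.asIdeal) :
    ∃ n : ℕ, ¬ p ∣ n ∧ Ideal.Quotient.mk v.asIdeal ((4 * k : ℤ) : 𝓞 K) = (n : 𝓞 K ⧸ v.asIdeal) := by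
  have hp0 : (p : ℤ) ≠ 0 := by exact_mod_cast hp.ne_zero
  set r : ℤ := (4 * k) % p with hr
  have hr0 : 0 ≤ r := Int.emod_nonneg _ hp0
  refine ⟨r.toNat, fun hd => ?_, ?_⟩
  · have hd' : (p : ℤ) ∣ r := by rw [← Int.toNat_of_nonneg hr0]; exact_mod_cast hd
    have h4k : (p : ℤ) ∣ 4 * k := by
      have h := dvd_add (Int.dvd_self_sub_emod (x := 4 * k) (m := (p : ℤ))) hd'
      rwa [hr, sub_add_cancel] at h
    rcases (Nat.prime_iff_prime_int.mp hp).dvd_or_dvd h4k with h4 | hk'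
    · have : p ∣ 2 ^ 2 := by exact_mod_cast h4
      exact hp2 ((Nat.prime_dvd_prime_iff_eq hp Nat.prime_two).mp (hp.dvd_of_dvd_pow this))
    · exact hpk hk'
  · have hcast : ((r.toNat : ℕ) : 𝓞 K ⧸ v.asIdeal) = Ideal.Quotient.mk v.asIdeal ((r : ℤ) : 𝓞 K) := by
      rw [map_intCast, ← Int.toNat_of_nonneg hr0]; push_cast; rw [Int.toNat_of_nonneg hr0]
    rw [hcast, Ideal.Quotient.eq]
    obtain ⟨q, hq⟩ := Int.dvd_self_sub_emod (x := 4 * k) (m := (p : ℤ))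
    rw [← hr] at hq
    have e : ((4 * k : ℤ) : 𝓞 K) - ((r : ℤ) : 𝓞 K) = (q : 𝓞 K) * (p : 𝓞 K) := by
      have h' : ((4 * k : ℤ) : 𝓞 K) - ((r : ℤ) : 𝓞 K) = ((4 * k - r : ℤ) : 𝓞 K) := by push_cast; ring
      rw [h', hq]; push_cast; ring
    rw [e]; exact v.asIdeal.mul_mem_left _ hv

/-- ★★ **Frobenius matching for `E^k : y² = x³ + k`** (Ireland–Rosen Thm. 18.4 on the character side; Silverman II Thm. 10.5): for a
prime `p ∤ 6k` and `𝔭_v ∋ p` of `K = ℚ(ω)`, `(36k) ∤ 𝔭_v`; at a SPLIT prime (`c • v ≠ v`, `p ≡ 1 (3)`)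
`ψ(v) + ψ(c • v) = a_p(E^k)` and `ψ(v) ψ(c • v) = p` (`SexticTwist.lFunction_apply_prime_split` with `ϖ = ϖ_v`, `σ = e`); at an INERT prime
(`c • v = v`, `p ≡ 2 (3)`) `a_p(E^k) = 0` and `ψ(v) = −p` (`ϖ_{(p)} = −p`, `(k/p²) = 1`, `(4k/p)₃ = 1`).
[cite: IrelandRosen1990, Ch. 18 §3 Theorem 4, §7] [cite: SilvermanATAEC1994, II Thm. 10.5 (b), Ex. 2.33] -/
theorem psi_frobenius {k : ℤ} (e : K →+* ℂ) {c : K ≃ₐ[ℚ] K} (hc : c ≠ 1) {p : ℕ} (hp : p.Prime) (hpk : ¬ (p : ℤ) ∣ 6 * k)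
    {v : HeightOneSpectrum (𝓞 K)} (hv : (p : 𝓞 K) ∈ v.asIdeal) :
    ¬ modulus k ≤ v.asIdeal ∧
    (c • v ≠ v → psi hζ k e v + psi hζ k e (c • v) = ((mordellCurve (k : ℚ)).LFunction p : ℂ) ∧
      psi hζ k e v * psi hζ k e (c • v) = p) ∧
    (c • v = v → (mordellCurve (k : ℚ)).LFunction p = 0 ∧ psi hζ k e v = -(p : ℂ)) := by
  have h6 := six_mul_not_mem_of_natCast_mem hp hpk hv
  obtain ⟨h2v, h3v, h4v⟩ := not_mem_of_six_mul_not_mem h6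
  have hpk' : ¬ (p : ℤ) ∣ k := fun h => hpk (dvd_mul_of_dvd_right h 6)
  have hp2 : p ≠ 2 := by rintro rfl; exact hpk (dvd_mul_of_dvd_left (by norm_num) k)
  have hp3 : p ≠ 3 := by rintro rfl; exact hpk (dvd_mul_of_dvd_left (by norm_num) k)
  refine ⟨(modulus_le_iff k v).not.mpr h6, ?_, ?_⟩
  · -- split
    intro hne
    have hp1 : p % 3 = 1 := by
      by_contra h1
      have h2 : p % 3 = 2 := by
        have : p % 3 ≠ 0 := fun h0 => hp3 ((Nat.prime_dvd_prime_iff_eq Nat.prime_three hp).mp (Nat.dvd_of_mod_eq_zero h0)).symm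
        omega
      exact hne (smul_eq_self_of_mod_three_eq_two c hp h2 hv)
    haveI := Fact.mk hp
    have hN := residueCard_eq_of_mod_three_eq_one hp hp1 hv
    obtain ⟨hap, hϖϖ⟩ := lFunction_apply_prime_split hζ (k := k) hp1 hpk' e hv hN (span_varpi hζ h3v) (varpi_sub_one_mem hζ h3v)
    have hz : psi hζ k e v = (legendreSym p k : ℂ) *
        e (cubicResidueSymbol v (Ideal.Quotient.mk v.asIdeal ((4 * k : ℤ) : 𝓞 K)) : K) * e (varpi hζ v : K) := by
      rw [psi_of_not_mem hζ e h6, coe_cubicLoc_of_not_mem hζ e h4v h3v, show Ideal.absNorm v.asIdeal = p from hN,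
        ← jacobiSym.legendreSym.to_jacobiSym]
    have hcz : psi hζ k e (c • v) = conj (psi hζ k e v) := psi_smul_eq_conj hζ e hc v
    refine ⟨by rw [hcz, hz]; exact hap.symm, ?_⟩
    rw [hcz, psi_of_not_mem hζ e h6, map_mul, map_mul, map_intCast]
    have hJ : (J(k | Ideal.absNorm v.asIdeal) : ℂ) * (J(k | Ideal.absNorm v.asIdeal) : ℂ) = 1 := by
      rw [← Int.cast_mul, ← sq, show Ideal.absNorm v.asIdeal = p from hN, jacobiSym.sq_one (gcd_eq_one_of_not_dvd hp hpk'),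
        Int.cast_one]
    have hC : (cubicLoc hζ ((4 * k : ℤ) : 𝓞 K) e v : ℂ) * conj (cubicLoc hζ ((4 * k : ℤ) : 𝓞 K) e v : ℂ) = 1 := by
      set u := cubicLoc hζ ((4 * k : ℤ) : 𝓞 K) e v
      have h3 : (u : ℂ) ^ 3 = 1 := by rw [← Units.val_pow_eq_pow_val, cubicLoc_pow_three, Units.val_one]
      have hn : ‖(u : ℂ)‖ = 1 := by
        have h' : ‖(u : ℂ)‖ ^ 3 = 1 := by rw [← norm_pow, h3, norm_one]
        exact (pow_eq_one_iff_of_nonneg (norm_nonneg _) (by norm_num)).mp h'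
      rw [Complex.mul_conj, Complex.normSq_eq_norm_sq, hn]; norm_num
    calc (J(k | Ideal.absNorm v.asIdeal) : ℂ) * (cubicLoc hζ ((4 * k : ℤ) : 𝓞 K) e v : ℂ) * e (varpi hζ v : K) *
          ((J(k | Ideal.absNorm v.asIdeal) : ℂ) * conj (cubicLoc hζ ((4 * k : ℤ) : 𝓞 K) e v : ℂ) * conj (e (varpi hζ v : K)))
        = ((J(k | Ideal.absNorm v.asIdeal) : ℂ) * (J(k | Ideal.absNorm v.asIdeal) : ℂ)) *
          ((cubicLoc hζ ((4 * k : ℤ) : 𝓞 K) e v : ℂ) * conj (cubicLoc hζ ((4 * k : ℤ) : 𝓞 K) e v : ℂ)) *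
          (e (varpi hζ v : K) * conj (e (varpi hζ v : K))) := by ring
      _ = p := by rw [hJ, hC, hϖϖ, one_mul, one_mul]
  · -- inert
    intro hcv
    have hp23 : p % 3 = 2 := by
      by_contra h2
      have h1 : p % 3 = 1 := by
        have : p % 3 ≠ 0 := fun h0 => hp3 ((Nat.prime_dvd_prime_iff_eq Nat.prime_three hp).mp (Nat.dvd_of_mod_eq_zero h0)).symm
        omega
      exact smul_ne_self_of_mod_three_eq_one hζ hc hp h1 hv hcv
    refine ⟨lFunction_mordellCurve_apply_prime_eq_zero hp hp23 hp2 hpk', ?_⟩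
    haveI := Fact.mk hp
    have hvp := asIdeal_eq_span_of_mod_three_eq_two hp hp23 hv
    have hN : v.residueCard = p ^ 2 := by
      show Ideal.absNorm v.asIdeal = p ^ 2; rw [hvp, EisensteinCubic.absNorm_span_natCast']
    -- the three factors: `(k/p²) = 1`, `(4k/(p))₃ = 1`, `ϖ_{(p)} = −p`
    have hJ : J(k | Ideal.absNorm v.asIdeal) = 1 := by
      rw [show Ideal.absNorm v.asIdeal = p ^ 2 from hN, jacobiSym.pow_right, jacobiSym.sq_one (gcd_eq_one_of_not_dvd hp hpk')]
    have hC : (cubicLoc hζ ((4 * k : ℤ) : 𝓞 K) e v : ℂ) = 1 := by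
      obtain ⟨n, hn, hmk⟩ := exists_nat_mk_four_mul_eq hp hp2 hpk' hv
      rw [coe_cubicLoc_of_not_mem hζ e h4v h3v, hmk, cubicResidueSymbol_natCast_eq_one_of_residueCard_eq_sq hζ hp23 hv hN hn]
      simp
    have hϖ : varpi hζ v = -(p : 𝓞 K) := by
      refine varpi_eq_of hζ h3v (by rw [Ideal.span_singleton_neg, hvp]) ?_
      obtain ⟨m, hm⟩ : 3 ∣ p + 1 := by omega
      have hm' : (p : 𝓞 K) + 1 = 3 * (m : 𝓞 K) := by exact_mod_cast hm
      exact Ideal.mem_span_singleton'.mpr ⟨-(m : 𝓞 K), by linear_combination hm'⟩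
    rw [psi_of_not_mem hζ e h6, hJ, hC, hϖ, Int.cast_one, one_mul, one_mul]
    push_cast
    rw [map_neg, map_natCast]

end Frobenius

section Datum

/-! ### §2 Ramification at `λ` and the packaged datum (universe `Type`, the currency of `not_isUnramifiedAt_heckeOfGross_of_ne`) -/

open WeierstrassCurve

variable {L : Type} [Field L] [NumberField L] {ξ : 𝓞 L} (hξ : IsPrimitiveRoot ξ 3) [IsCyclotomicExtension {3} ℚ L]

omit [IsCyclotomicExtension {3} ℚ L] in
/-- `a ≡ 1 (mod J)` and `𝔣 ∣ J · I` with `I` supported at `𝔭_w` give `a ≡ 1 (mod 𝔭_v^{n_v})` for `v ≠ w` (private copy of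
`QuarticTwistGrossencharakterRamification.sub_one_mem_pow_modulusExp_of_dvd`, not imported). [folklore] -/
private theorem sub_one_mem_pow_modulusExp_of_dvd' {𝔣 J I : Ideal (𝓞 L)} {w : HeightOneSpectrum (𝓞 L)} (h𝔣 : 𝔣 ∣ J * I)
    (hI : ∀ v : HeightOneSpectrum (𝓞 L), v.asIdeal ∣ I → v = w) {a : 𝓞 L} (ha : a - 1 ∈ J)
    {v : HeightOneSpectrum (𝓞 L)} (hv : v ≠ w) : a - 1 ∈ v.asIdeal ^ modulusExp 𝔣 v := by
  have h1 : v.asIdeal ^ modulusExp 𝔣 v ∣ J * I := (pow_modulusExp_dvd (𝔪 := 𝔣) v).trans h𝔣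
  exact Ideal.le_of_dvd (v.prime.pow_dvd_of_dvd_mul_right _ (fun h => hv (hI v h)) h1) ha

/-- ★★ **`ψ` is RAMIFIED at the prime `λ` above `3`**, for EVERY `k ≠ 0` (`E^k` has bad reduction at `3`): the rational witness
`a = 1 + 4m²`, `|k| = 3^t m` with `3 ∤ m`, is `≡ 2 (mod 3)`, prime to `6k`, `≡ 1` modulo the prime-to-`3` part `(4m)` of `(36k)`, and
`ψ̃((a)) = −S·a ≠ a` — the criterion `not_isUnramifiedAt_heckeOfGross_of_ne`.
[cite: IrelandRosen1990, Ch. 18 §7 («if `P ∣ 6D` then `χ(P) = 0`»)] [cite: SilvermanATAEC1994, II Thm. 10.5] -/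
theorem not_isUnramifiedAt_heckeOfGross_psi_three {k : ℤ} (hk : k ≠ 0) (w₀ : InfinitePlace L) {w : HeightOneSpectrum (𝓞 L)}
    (h3w : (3 : 𝓞 L) ∈ w.asIdeal) :
    ¬ (heckeOfGross (modulus_ne_bot hk) (isGrossencharakter_psi_one_zero hξ hk w₀)).IsUnramifiedAt w := by
  classical
  haveI : IsTotallyComplex L := IsCyclotomicExtension.Rat.isTotallyComplex L (by norm_num : 2 < 3)
  haveI := subsingleton_infinitePlace (K := L)
  -- `|k| = 3^t m`, `3 ∤ m`; the witness `a = 1 + 4m²`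
  obtain ⟨t, m, hm3, hkm⟩ := Nat.exists_eq_pow_mul_and_not_dvd (Int.natAbs_ne_zero.mpr hk) 3 (by norm_num)
  set a : ℤ := 1 + 4 * (m : ℤ) ^ 2 with ha
  have ha3 : a % 3 = 2 := by
    have hm3' : (m : ℤ) % 3 = 1 ∨ (m : ℤ) % 3 = 2 := by omega
    have hsq : (m : ℤ) ^ 2 % 3 = 1 := by
      rcases hm3' with h | h <;> rw [pow_two, Int.mul_emod, h] <;> norm_num
    omega
  -- `(a, 6k) = 1`
  have hcop6k : IsCoprime a (6 * k) := by
    have h2 : IsCoprime a 2 := ⟨1, -(2 * (m : ℤ) ^ 2), by rw [ha]; ring⟩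
    obtain ⟨j, hj⟩ : ∃ j : ℤ, a = 3 * j + 2 := ⟨a / 3, by omega⟩
    have h3 : IsCoprime a 3 := ⟨2, -(2 * j + 1), by rw [hj]; ring⟩
    have hm' : IsCoprime a (m : ℤ) := ⟨1, -(4 * (m : ℤ)), by rw [ha]; ring⟩
    have habs : IsCoprime a (k.natAbs : ℤ) := by
      rw [hkm]; push_cast; exact h3.pow_right.mul_right hm'
    have hk' : IsCoprime a k := habs.of_isCoprime_of_dvd_right (Int.dvd_natAbs.mpr dvd_rfl)
    rw [show (6 : ℤ) * k = 2 * 3 * k by ring]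
    exact (h2.mul_right h3).mul_right hk'
  have h𝔣w : modulus k ≤ w.asIdeal := by
    rw [modulus_le_iff, show ((6 * k : ℤ) : 𝓞 L) = 3 * ((2 * k : ℤ) : 𝓞 L) by push_cast; ring]
    exact w.asIdeal.mul_mem_right _ h3w
  refine not_isUnramifiedAt_heckeOfGross_of_ne (modulus_ne_bot hk) (isGrossencharakter_psi_one_zero hξ hk w₀) h𝔣w
    (a := (a : 𝓞 L)) (fun haw => ?_) (isCoprime_span_intCast_modulus (K := L) hcop6k) (fun v hv _ => ?_) ?_
  · -- `a ∉ 𝔭_w`: `a ≡ 2 (mod 3)` and `3 ∈ 𝔭_w`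
    obtain ⟨j, hj⟩ : ∃ j : ℤ, a = 3 * j + 2 := ⟨a / 3, by omega⟩
    apply w.isPrime.ne_top
    rw [Ideal.eq_top_iff_one]
    have e1 : (1 : 𝓞 L) = 3 * ((j : 𝓞 L) + 1) - (a : 𝓞 L) := by
      have : ((a : ℤ) : 𝓞 L) = ((3 * j + 2 : ℤ) : 𝓞 L) := by rw [← hj]
      rw [this]; push_cast; ring
    rw [e1]
    exact w.asIdeal.sub_mem (w.asIdeal.mul_mem_right _ h3w) haw
  · -- congruences off `λ`: `(36k) ∣ (4m) · (3^{t+2})`, `a − 1 = m · 4m`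
    refine sub_one_mem_pow_modulusExp_of_dvd' (J := Ideal.span {((4 * m : ℕ) : 𝓞 L)}) (I := Ideal.span {((3 : 𝓞 L) ^ (t + 2))})
      (w := w) ?_ (fun v' hv' => ?_) ?_ hv
    · rw [Ideal.dvd_iff_le, Ideal.span_singleton_mul_span_singleton, modulus, Ideal.span_singleton_le_span_singleton]
      have hz : (36 * k : ℤ) ∣ ((4 * m : ℕ) : ℤ) * 3 ^ (t + 2) := by
        have h1 : ((4 * m : ℕ) : ℤ) * 3 ^ (t + 2) = 36 * (k.natAbs : ℤ) := by rw [hkm]; push_cast; ring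
        rw [h1]; exact mul_dvd_mul_left 36 (Int.dvd_natAbs.mpr dvd_rfl)
      have := map_dvd (Int.castRingHom (𝓞 L)) hz
      simpa only [eq_intCast, Int.cast_mul, Int.cast_natCast, Int.cast_pow, Int.cast_ofNat] using this
    · have h3v' : (3 : 𝓞 L) ∈ v'.asIdeal := by
        rw [← Ideal.span_singleton_pow] at hv'
        exact Ideal.le_of_dvd (v'.prime.dvd_of_dvd_pow hv') (Ideal.mem_span_singleton_self _)
      exact eq_of_three_mem hξ h3v' h3w
    · exact Ideal.mem_span_singleton'.mpr ⟨(m : 𝓞 L), by rw [ha]; push_cast; ring⟩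
  · -- the value
    rw [Fintype.prod_subsingleton _ w₀, zpow_one, zpow_zero, mul_one, show (((a : ℤ) : 𝓞 L) : L) = (a : L) by norm_cast,
      map_intCast]
    exact idealPow_psi_span_intCast_ne hξ hk w₀.embedding ha3 hcop6k


/-- ★★★ **The Größencharakter datum of the sextic twists `E^k : y² = x³ + k` over `K = ℚ(ω)`, packaged in the shape of Deuring's
theorem** (`k ≠ 0`, `c ≠ 1`, `w₀` an infinite place): `𝔣 = (36k) ≠ 0` with `𝔣 ∣ 𝔭 ↔ 6k ∈ 𝔭`, `ψ₀ = psi` with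
`IsGrossencharakter 𝔣 (1,0) ψ₀` (clause (i)), `ψ₀(c • v) = conj ψ₀(v)` (clause (ii)), at every `v ∣ p ∤ 6k` the Frobenius values against
`a_p(E^k)` (clause (iv): split `ψ₀v + ψ₀(cv) = a_p`, `ψ₀v ψ₀(cv) = p`; inert `a_p = 0`, `ψ₀ v = −p`), the Hecke character `heckeOfGross ψ₀`
RAMIFIED at the prime above `3`, and the rational witnesses `ψ̃₀((a)) ≠ a` (`a ≡ 2 (3)`, `(a, 6k) = 1`).
[cite: IrelandRosen1990, Ch. 18 §3 Theorem 4, §6 Theorem 7, §7] [cite: SilvermanATAEC1994, II Thm. 9.2, Thm. 10.5] -/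
theorem exists_isGrossencharakter_datum (hξ : IsPrimitiveRoot ξ 3) {k : ℤ} (hk : k ≠ 0) {c : L ≃ₐ[ℚ] L} (hc : c ≠ 1) (w₀ : InfinitePlace L) :
    ∃ (𝔣 : Ideal (𝓞 L)) (ψ₀ : HeightOneSpectrum (𝓞 L) → ℂ) (h𝔣 : 𝔣 ≠ ⊥)
      (hψ₀ : IsGrossencharakter 𝔣 (fun _ => 1) (fun _ => 0) ψ₀),
      (∀ v : HeightOneSpectrum (𝓞 L), 𝔣 ≤ v.asIdeal ↔ ((6 * k : ℤ) : 𝓞 L) ∈ v.asIdeal) ∧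
      (∀ v : HeightOneSpectrum (𝓞 L), ψ₀ (c • v) = conj (ψ₀ v)) ∧
      (∀ p : ℕ, p.Prime → ¬ (p : ℤ) ∣ 6 * k → ∀ v : HeightOneSpectrum (𝓞 L), (p : 𝓞 L) ∈ v.asIdeal →
        ¬ 𝔣 ≤ v.asIdeal ∧
        (c • v ≠ v → ψ₀ v + ψ₀ (c • v) = ((mordellCurve (k : ℚ)).LFunction p : ℂ) ∧ ψ₀ v * ψ₀ (c • v) = p) ∧
        (c • v = v → (mordellCurve (k : ℚ)).LFunction p = 0 ∧ ψ₀ v = -(p : ℂ))) ∧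
      (∀ w : HeightOneSpectrum (𝓞 L), (3 : 𝓞 L) ∈ w.asIdeal → ¬ (heckeOfGross h𝔣 hψ₀).IsUnramifiedAt w) ∧
      (∀ a : ℤ, a % 3 = 2 → IsCoprime a (6 * k) → idealPow L ψ₀ (Ideal.span {(a : 𝓞 L)}) ≠ (a : ℂ)) :=
  ⟨modulus k, psi hξ k w₀.embedding, modulus_ne_bot hk, isGrossencharakter_psi_one_zero hξ hk w₀, modulus_le_iff k,
    fun v => psi_smul_eq_conj hξ w₀.embedding hc v, fun _ hp hpk _ hv => psi_frobenius hξ w₀.embedding hc hp hpk hv,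
    fun _ h3w => not_isUnramifiedAt_heckeOfGross_psi_three hξ hk w₀ h3w,
    fun _ ha3 ha => idealPow_psi_span_intCast_ne hξ hk w₀.embedding ha3 ha⟩

/-- ★★ **The algebraic Hecke character of `ℚ(ω)` attached to `E^k`** (`ψ = heckeOfGross psi`, Neukirch VII (6.14)): infinity type `(1, 0)`,
ramified at the prime above `3`, and at every `v ∣ p ∤ 6k` unramified with `ψ(ϖ_{c•v}) = conj ψ(ϖ_v)` and Deuring's split/inert values against
`a_p(E^k)` — clauses (i), (ii), (iv) of `Deuring_exists_heckeCharacter_of_maximalCM` on the row `j = 0`, for EVERY `k ≠ 0`.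
[cite: IrelandRosen1990, Ch. 18 §7 («`L(E, s) = L(s, χ)`»)] [cite: SilvermanATAEC1994, II Thm. 9.2 (a), Thm. 10.5 (b)] [cite: NeukirchANT1999, Ch. VII §6 Cor. (6.14)] -/
theorem exists_heckeCharacter_psi (hξ : IsPrimitiveRoot ξ 3) {k : ℤ} (hk : k ≠ 0) {c : L ≃ₐ[ℚ] L} (hc : c ≠ 1) (w₀ : InfinitePlace L) :
    ∃ ψ : HeckeCharacter L, ψ.HasInfinityType (fun _ => 1) (fun _ => 0) ∧
      (∀ w : HeightOneSpectrum (𝓞 L), (3 : 𝓞 L) ∈ w.asIdeal → ¬ ψ.IsUnramifiedAt w) ∧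
      ∀ p : ℕ, p.Prime → ¬ (p : ℤ) ∣ 6 * k → ∀ v : HeightOneSpectrum (𝓞 L), (p : 𝓞 L) ∈ v.asIdeal →
        ψ.IsUnramifiedAt v ∧ ψ.valueAtUniformizer (c • v) = conj (ψ.valueAtUniformizer v) ∧
        (c • v ≠ v → ψ.valueAtUniformizer v + ψ.valueAtUniformizer (c • v) = ((mordellCurve (k : ℚ)).LFunction p : ℂ) ∧
          ψ.valueAtUniformizer v * ψ.valueAtUniformizer (c • v) = p) ∧
        (c • v = v → (mordellCurve (k : ℚ)).LFunction p = 0 ∧ ψ.valueAtUniformizer v = -(p : ℂ)) := by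
  have h𝔣 : modulus (K := L) k ≠ ⊥ := modulus_ne_bot hk
  have hψ := isGrossencharakter_psi_one_zero hξ hk w₀
  refine ⟨heckeOfGross h𝔣 hψ, heckeOfGross_hasInfinityType h𝔣 hψ,
    fun w h3w => not_isUnramifiedAt_heckeOfGross_psi_three hξ hk w₀ h3w, fun p hp hpk v hv => ?_⟩
  obtain ⟨hv', hsplit, hinert⟩ := psi_frobenius hξ w₀.embedding hc hp hpk hv
  have hcv : (p : 𝓞 L) ∈ (c • v).asIdeal := by
    have h := (intCast_mem_smul_iff c v (p : ℤ)).mpr (by rwa [Int.cast_natCast])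
    rwa [Int.cast_natCast] at h
  have hcv' : ¬ modulus k ≤ (c • v).asIdeal := (psi_frobenius hξ w₀.embedding hc hp hpk hcv).1
  rw [heckeOfGross_valueAtUniformizer h𝔣 hψ hv', heckeOfGross_valueAtUniformizer h𝔣 hψ hcv']
  exact ⟨heckeOfGross_isUnramifiedAt h𝔣 hψ hv', psi_smul_eq_conj hξ w₀.embedding hc v, hsplit, hinert⟩

end Datum

end Literature.NumberTheory.EllipticCurves.SexticTwist

end
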